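import Summits.HubbardSuperconductivity.HubbardSuperconductivity.Theses.LogColdTorus
import Summits.HubbardSuperconductivity.HubbardSuperconductivity.Theorems.AbelianDualityThermalToGroundAverage
import Literature.Barriers.HubbardSuperconductivity.HohenbergMerminWagnerPairing
import Literature.MathematicalPhysics.QuantumLattice.HubbardTorusFluxThermalBlochBound
import HarnessLib

/-!
# Route `LogColdTorus`, crux `LogColdDWaveOrder` (stmt-HubbardSuperconductivity-8807):
# the Koma–Tasaki bound IN THE CANONICAL SECTOR (the crux's own functional)

The crux reads the Gibbs state of the pure Hubbard Hamiltonian COMPRESSED to an occupation-defined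
coordinate sector, `Matrix.gibbsState β ((hubbardTorus 2 L 1 U).toBlock p p)` on
`(Δ_d†Δ_d).toBlock p p`. The tree's Koma–Tasaki facts (`norm_thermalCorr_localPair_le`, support
`LogScaleNecessity`) are grand-canonical (full Fock space); this file is the canonical-sector twin
the route lists as unfiled — in fact the printed form of the theorem (Koma–Tasaki's eq. (3) fixes
the electron density: "our result … applies to grand canonical averages as well"), because the
gauge `exp[-Σ φ_u n_u]` is DIAGONAL in the occupation basis and so commutes with the compression:
* `norm_gibbsState_toBlock_le_of_diagonal_gauge` — the model-independent a priori bound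
  `|⟨A.toBlock p p⟩_β| ≤ |κ| ‖A‖ e^{βc}` for the Gibbs state of `H.toBlock p p`, every predicate `p`
  (`toBlock_diagonal_mul_mul_diagonal`, `norm_toBlock_le`, `norm_gibbsState_le_of_gauge`);
* `norm_gibbsState_toBlock_bondPairCorr_le_exp` — bond pairs, any finite graph, any sector;
* `norm_gibbsState_toBlock_localPairCorr_le`, `logColdSector_pairDecay` (registered closed form) —
  on `(ℤ/Lℤ)²`: `|ω^{p}_{β,L}((P_x)† P_y)| ≤ C_g (dist(x,y)+1)^{-f(β|t|)}` uniformly in `L`, `U`, `μ`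
  and the sector, with the grand-canonical constants `pairFieldDecayConst g`, `pairDecayExponent`.

Sources: T. Koma, H. Tasaki, PRL 68 (1992) 3248 = arXiv:cond-mat/9709068, Theorem (eq. (2)),
definition (3) and proof eqs. (5)–(12); O. McBryan, T. Spencer, CMP 53 (1977) 299. No definitions.
-/

-- the mandated namespace `Summit.<Summit>.<Problem>.Theorems` repeats `HubbardSuperconductivity`
-- (single-problem summit, D-0017), which the `dupNamespace` linter flags on every declaration
set_option linter.dupNamespace false

noncomputable section

namespace Summit.HubbardSuperconductivity.HubbardSuperconductivity.Theorems.LogColdTorus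

open Matrix Finset NormedSpace Literature.MathematicalPhysics.QuantumLattice
  Literature.Probability.LatticeModels Literature.Barriers.HubbardSuperconductivity
  Summit.HubbardSuperconductivity.HubbardSuperconductivity.Theorems
open scoped Matrix.Norms.L2Operator ComplexOrder

/-! ### Compression algebra -/

section Blocks

variable {n : Type*}

/-- Compression commutes with the conjugate transpose on a principal block. [folklore] -/
theorem conjTranspose_toBlock (M : Matrix n n ℂ) (p : n → Prop) :
    (M.toBlock p p)ᴴ = Mᴴ.toBlock p p := by
  ext a b
  simp only [conjTranspose_apply, toBlock_apply]

/-- Compression is homogeneous. [folklore] -/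
theorem toBlock_smul (c : ℂ) (M : Matrix n n ℂ) (p q : n → Prop) :
    (c • M).toBlock p q = c • M.toBlock p q := by
  ext a b
  simp only [toBlock_apply, Matrix.smul_apply]

/-- Compression is additive. [folklore] -/
theorem toBlock_add (M N : Matrix n n ℂ) (p q : n → Prop) :
    (M + N).toBlock p q = M.toBlock p q + N.toBlock p q := by
  ext a b
  simp only [toBlock_apply, Matrix.add_apply]

end Blocks

/-! ### The a priori gauge bound survives compression to any occupation sector -/

section Abstract

variable {n : Type*} [Fintype n]

/-- **Koma–Tasaki's a priori bound in a sector.** Let `H` be Hermitian and let a DIAGONAL gauge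
`D = diag d` with inverse `diag e` (`d i · e i = 1`) satisfy `D A D⁻¹ = κ A` and
`D H D⁻¹ + (D H D⁻¹)ᴴ = 2(H + V)` with `‖V‖ ≤ c`. Then for every predicate `p` on the basis with a
non-empty block and every `β ≥ 0`, the Gibbs state of the compressed Hamiltonian `H.toBlock p p`
obeys `|⟨A.toBlock p p⟩_β| ≤ |κ| ‖A‖ e^{βc}`: a diagonal conjugation commutes with the compression,
the compressed `V` has norm `≤ ‖V‖`, and `norm_gibbsState_le_of_gauge` applies on the block.
(Koma–Tasaki's gauge `exp[-Σ φ_u n_u]` is diagonal in the occupation basis, which is why their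
theorem holds for the canonical average (3) as printed.)
[cite: KomaTasakiPRL1992, eqs. (3), (5)–(12)] -/
theorem norm_gibbsState_toBlock_le_of_diagonal_gauge {inst : DecidableEq n} {H A V : Matrix n n ℂ}
    (hH : H.IsHermitian) {d e : n → ℂ} (hde : ∀ i, d i * e i = 1) {κ : ℂ}
    (hA : @diagonal n ℂ inst _ d * A * @diagonal n ℂ inst _ e = κ • A)
    (hV : @diagonal n ℂ inst _ d * H * @diagonal n ℂ inst _ e +
        (@diagonal n ℂ inst _ d * H * @diagonal n ℂ inst _ e)ᴴ = (2 : ℂ) • (H + V))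
    {c : ℝ} (hc : ‖V‖ ≤ c) {β : ℝ} (hβ : 0 ≤ β)
    (p : n → Prop) [Fintype {a // p a}] [DecidableEq {a // p a}] [DecidablePred p]
    [Nonempty {a // p a}] :
    ‖gibbsState β (H.toBlock p p) (A.toBlock p p)‖ ≤ ‖κ‖ * ‖A‖ * Real.exp (β * c) := by
  set D' : Matrix {a // p a} {a // p a} ℂ := diagonal fun a => d a with hD'
  set E' : Matrix {a // p a} {a // p a} ℂ := diagonal fun a => e a with hE'
  have hed : ∀ i, e i * d i = 1 := fun i => by rw [mul_comm]; exact hde i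
  have hDE : D' * E' = 1 := by
    rw [hD', hE', diagonal_mul_diagonal, ← diagonal_one]
    exact congrArg diagonal (funext fun a => hde a)
  have hED : E' * D' = 1 := by
    rw [hD', hE', diagonal_mul_diagonal, ← diagonal_one]
    exact congrArg diagonal (funext fun a => hed a)
  have hD : IsUnit D' := ⟨⟨D', E', hDE, hED⟩, rfl⟩
  have hDinv : D'⁻¹ = E' := Matrix.inv_eq_right_inv hDE
  have hblockA : (@diagonal n ℂ inst _ d * A * @diagonal n ℂ inst _ e).toBlock p p =
      D' * A.toBlock p p * E' := toBlock_diagonal_mul_mul_diagonal d e A p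
  have hblockH : (@diagonal n ℂ inst _ d * H * @diagonal n ℂ inst _ e).toBlock p p =
      D' * H.toBlock p p * E' := toBlock_diagonal_mul_mul_diagonal d e H p
  have hA' : D' * A.toBlock p p * D'⁻¹ = κ • A.toBlock p p := by
    rw [hDinv, ← hblockA, hA, toBlock_smul]
  have hV' : D' * H.toBlock p p * D'⁻¹ + (D' * H.toBlock p p * D'⁻¹)ᴴ =
      (2 : ℂ) • (H.toBlock p p + V.toBlock p p) := by
    rw [hDinv, ← hblockH, conjTranspose_toBlock, ← toBlock_add, ← toBlock_add, ← toBlock_smul, hV]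
  have hc' : ‖V.toBlock p p‖ ≤ c := (norm_toBlock_le V p).trans hc
  have h := norm_gibbsState_le_of_gauge (hH.submatrix _) hD hA' hV' hc' hβ
  have hAn : ‖A.toBlock p p‖ ≤ ‖A‖ := norm_toBlock_le A p
  exact h.trans (by gcongr)

end Abstract

/-! ### Singlet bond pairs in a sector of the Hubbard model on a finite graph -/

section Graph

variable {Λ : Type*} [LinearOrder Λ] [Fintype Λ] (G : SimpleGraph Λ) [DecidableRel G.Adj]

/-- **Koma–Tasaki's a priori bound for bond pairs in an occupation sector** (eqs. (6)–(12) before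
the choice of `φ`, footnote [10], canonical form (3)): for `H(t, U) - μN` on an arbitrary finite
graph compressed to ANY predicate `p` on occupation sets with a non-empty block, every real site
function `φ`, `β ≥ 0` and sites `u, v, w, z`,
`|ω^{p}_β((b_{uv})† b_{wz})| ≤ 4 · exp[-(φ_u + φ_v) + (φ_w + φ_z)] · exp[β |t| Σ_a Σ_b [a ∼ b] 2(cosh(φ_a - φ_b) - 1)]`.
[cite: KomaTasakiPRL1992, eqs. (3), (6)–(12) and footnote [10]] -/
theorem norm_gibbsState_toBlock_bondPairCorr_le_exp (t U μ : ℝ) {β : ℝ} (hβ : 0 ≤ β)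
    (φ : Λ → ℝ) (u v w z : Λ) (p : Finset (Orb Λ) → Prop) [Fintype {s // p s}]
    [DecidableEq {s // p s}] [DecidablePred p] [Nonempty {s // p s}] :
    ‖gibbsState β ((hamiltonianWith G t U μ).toBlock p p)
        (((bondPair u v)ᴴ * bondPair w z).toBlock p p)‖ ≤
      4 * Real.exp (-(φ u + φ v) + (φ w + φ z)) *
        Real.exp (β * (|t| * ∑ a : Λ, ∑ b : Λ,
          if G.Adj a b then 2 * (Real.cosh (φ a - φ b) - 1) else 0)) := by
  set A : Matrix (Finset (Orb Λ)) (Finset (Orb Λ)) ℂ := (bondPair u v)ᴴ * bondPair w z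
    with hA_def
  set V : Matrix (Finset (Orb Λ)) (Finset (Orb Λ)) ℂ :=
    -(t : ℂ) • hoppingForm G (fun a b => Real.cosh (φ a - φ b) - 1) with hV_def
  set c : ℝ := |t| * ∑ a : Λ, ∑ b : Λ,
    if G.Adj a b then 2 * (Real.cosh (φ a - φ b) - 1) else 0 with hc_def
  set k : ℝ := Real.exp (-(φ u + φ v) + (φ w + φ z)) with hk_def
  have hH : (hamiltonianWith G t U μ).IsHermitian := isHermitian_hamiltonianWith G t U μ
  -- the diagonal site gauge `G(φ) = diag d`, `G(-φ) = diag e`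
  set d : Finset (Orb Λ) → ℂ := fun s => ((Real.exp (-∑ i ∈ s, φ (ofLex i).1) : ℝ) : ℂ)
    with hd_def
  set e : Finset (Orb Λ) → ℂ := fun s => ((Real.exp (-∑ i ∈ s, (-φ) (ofLex i).1) : ℝ) : ℂ)
    with he_def
  have hde : ∀ s, d s * e s = 1 := by
    intro s
    rw [hd_def, he_def]
    dsimp only
    rw [← Complex.ofReal_mul, ← Real.exp_add]
    have : (-∑ i ∈ s, φ (ofLex i).1) + -∑ i ∈ s, (-φ) (ofLex i).1 = 0 := by
      simp only [Pi.neg_apply, Finset.sum_neg_distrib, neg_neg]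
      ring
    rw [this, Real.exp_zero, Complex.ofReal_one]
  have hA : siteGauge φ * A * siteGauge (-φ) = ((k : ℝ) : ℂ) • A :=
    siteGauge_mul_bondPairCorr_mul φ u v w z
  have hV : siteGauge φ * hamiltonianWith G t U μ * siteGauge (-φ) +
      (siteGauge φ * hamiltonianWith G t U μ * siteGauge (-φ))ᴴ =
      (2 : ℂ) • (hamiltonianWith G t U μ + V) :=
    siteGauge_conj_hamiltonianWith_add_conjTranspose G φ t U μ
  have hc : ‖V‖ ≤ c := norm_hoppingPerturbation_le G φ t
  have h := norm_gibbsState_toBlock_le_of_diagonal_gauge (d := d) (e := e) hH hde hA hV hc hβ p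
  have hk : ‖((k : ℝ) : ℂ)‖ = k := by
    rw [Complex.norm_real, Real.norm_of_nonneg (Real.exp_pos _).le]
  calc ‖gibbsState β ((hamiltonianWith G t U μ).toBlock p p) (A.toBlock p p)‖
      ≤ ‖((k : ℝ) : ℂ)‖ * ‖A‖ * Real.exp (β * c) := h
    _ ≤ ‖((k : ℝ) : ℂ)‖ * 4 * Real.exp (β * c) := by
        gcongr
        exact norm_bondPairCorr_le_four u v w z
    _ = 4 * k * Real.exp (β * c) := by rw [hk]; ring

end Graph

/-! ### On the torus `(ℤ/Lℤ)²`: the radial test potential -/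

section Torus

variable {L : ℕ} [NeZero L]

/-- **Koma–Tasaki bound for bond pairs in a sector, on `(ℤ/Lℤ)²`**: for all `t, U, μ`, `β ≥ 0`,
every predicate `p` on occupation sets with a non-empty block, sites `x, y` and partner sites
`x', y'` within torus distance `1` of `x`, `y`:
`|ω^{p}_{β,L}((b_{xx'})† b_{yy'})| ≤ 4e² (dist(x,y)+1)^{-f(β|t|)}`, `f = pairDecayExponent`, uniformly in
`L`, `U`, `μ` and the sector — the radial test potential of the grand-canonical tree theorem
`norm_thermalCorr_bondPair_torus_le`, fed into the sector a priori bound.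
[cite: KomaTasakiPRL1992, Theorem eq. (2), eq. (3), footnote [10], proof eqs. (5)–(12)] -/
theorem norm_gibbsState_toBlock_bondPair_torus_le (t U μ : ℝ) {β : ℝ} (hβ : 0 ≤ β)
    (p : Finset (Orb (FermionTorus 2 L)) → Prop) [Fintype {s // p s}] [DecidableEq {s // p s}]
    [DecidablePred p] [Nonempty {s // p s}]
    (x x' y y' : TorusSite 2 L) (hx' : torusDist x' x ≤ 1) (hy' : torusDist y' y ≤ 1) :
    ‖gibbsState β ((hubbardTorusWith 2 L t U μ).toBlock p p)
        (((bondPair (FermionTorus.ofTorusSite x) (FermionTorus.ofTorusSite x'))ᴴ *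
          bondPair (FermionTorus.ofTorusSite y) (FermionTorus.ofTorusSite y')).toBlock p p)‖ ≤
      4 * Real.exp 2 * ((torusDist x y : ℝ) + 1) ^ (-pairDecayExponent (β * |t|)) := by
  -- constants, as in `koma_tasaki_2d_holds`
  set B : ℝ := 128 * (β * |t|) with hB
  have hB0 : 0 ≤ B := by positivity
  set q : ℝ := 1 / (1 + B) with hq
  have hq0 : 0 < q := by positivity
  have hq1 : q ≤ 1 := by
    rw [hq, div_le_one (by positivity)]
    linarith
  set f : ℝ := 2 * q - B * q ^ 2 with hf
  have hfeq : pairDecayExponent (β * |t|) = f := by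
    rw [pairDecayExponent_eq (by positivity : 0 ≤ β * |t|)]
  -- the radial potential centred at `y`, radius `R = dist(x, y)`
  set R : ℕ := torusDist x y with hR
  set φ : TorusSite 2 L → ℝ := radialPotential L y R q with hφ
  have key := norm_gibbsState_toBlock_bondPairCorr_le_exp (fermionTorusGraph 2 L) t U μ hβ
    (fun u => φ (FermionTorus.toTorusSite u)) (FermionTorus.ofTorusSite x)
    (FermionTorus.ofTorusSite x') (FermionTorus.ofTorusSite y) (FermionTorus.ofTorusSite y') p
  have hsumeq : (∑ u : FermionTorus 2 L, ∑ v : FermionTorus 2 L,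
      if (fermionTorusGraph 2 L).Adj u v then
        2 * (Real.cosh (φ (FermionTorus.toTorusSite u) - φ (FermionTorus.toTorusSite v)) - 1)
      else 0) =
      ∑ a : TorusSite 2 L, ∑ b : TorusSite 2 L,
        if (torusGraph 2 L).Adj a b then 2 * (Real.cosh (φ a - φ b) - 1) else 0 := by
    refine Fintype.sum_equiv FermionTorus.equivTorusSite _ _ fun u => ?_
    refine Fintype.sum_equiv FermionTorus.equivTorusSite _ _ fun v => ?_
    simp [FermionTorus.equivTorusSite]
  simp only [FermionTorus.toTorusSite_ofTorusSite] at key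
  rw [hsumeq] at key
  refine Eq.trans_le ?_ (key.trans ?_)
  · rfl
  -- values of the potential at the four sites
  have hφx : φ x = q * (harmonic R : ℝ) := radialPotential_of_le y q le_rfl
  have hφy : φ y = 0 := radialPotential_center y R q
  have hφx' : q * (harmonic R : ℝ) - q ≤ φ x' := by
    refine radialPotential_ge_of y hq0.le ?_
    calc R = torusDist x y := hR
      _ ≤ torusDist x x' + torusDist x' y := torusDist_triangle' x x' y
      _ ≤ 1 + torusDist x' y := by rw [torusDist_comm' x x']; exact Nat.add_le_add_right hx' _
      _ = torusDist x' y + 1 := Nat.add_comm _ _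
  have hφy' : φ y' ≤ q := radialPotential_le_of y R hq0.le hy'
  have hexp : -(φ x + φ x') + (φ y + φ y') ≤ -2 * (q * (harmonic R : ℝ)) + 2 := by
    rw [hφx, hφy]
    linarith
  -- energy
  have hE := radialPotential_energy_le (L := L) y R hq0.le hq1
  have hβt : 0 ≤ β * |t| := by positivity
  have hE' : β * (|t| * ∑ a : TorusSite 2 L, ∑ b : TorusSite 2 L,
      (if (torusGraph 2 L).Adj a b then 2 * (Real.cosh (φ a - φ b) - 1) else 0)) ≤
      B * q ^ 2 * (harmonic R : ℝ) := by
    calc β * (|t| * ∑ a : TorusSite 2 L, ∑ b : TorusSite 2 L,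
          (if (torusGraph 2 L).Adj a b then 2 * (Real.cosh (φ a - φ b) - 1) else 0))
        = (β * |t|) * ∑ a : TorusSite 2 L, ∑ b : TorusSite 2 L,
          (if (torusGraph 2 L).Adj a b then 2 * (Real.cosh (φ a - φ b) - 1) else 0) := by
          ring
      _ ≤ (β * |t|) * (128 * q ^ 2 * (harmonic R : ℝ)) := mul_le_mul_of_nonneg_left hE hβt
      _ = B * q ^ 2 * (harmonic R : ℝ) := by rw [hB]; ring
  -- arithmetic
  have hHR : Real.log ((R : ℝ) + 1) ≤ (harmonic R : ℝ) := by
    have := log_add_one_le_harmonic R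
    push_cast at this
    exact this
  have hf0 : 0 < f := by rw [← hfeq]; exact pairDecayExponent_pos hβt
  have hRpos : (0 : ℝ) < (R : ℝ) + 1 := by positivity
  calc 4 * Real.exp (-(φ x + φ x') + (φ y + φ y')) *
        Real.exp (β * (|t| * ∑ a : TorusSite 2 L, ∑ b : TorusSite 2 L,
          (if (torusGraph 2 L).Adj a b then 2 * (Real.cosh (φ a - φ b) - 1) else 0)))
      ≤ 4 * Real.exp (-2 * (q * (harmonic R : ℝ)) + 2) *
          Real.exp (B * q ^ 2 * (harmonic R : ℝ)) := by
        gcongr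
    _ = 4 * Real.exp 2 * Real.exp (-(f * (harmonic R : ℝ))) := by
        rw [mul_assoc 4 (Real.exp 2), ← Real.exp_add, mul_assoc 4, ← Real.exp_add, hf]
        congr 2
        ring
    _ ≤ 4 * Real.exp 2 * Real.exp (-(f * Real.log ((R : ℝ) + 1))) := by
        gcongr
    _ = 4 * Real.exp 2 * (((torusDist x y : ℕ) : ℝ) + 1) ^ (-pairDecayExponent (β * |t|)) := by
        rw [hfeq, ← hR, Real.rpow_def_of_pos hRpos]
        congr 2
        ring

/-! ### Local pairs with an arbitrary form factor -/

variable (g : Site 2 → ℝ)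

/-- Bilinear expansion of the compressed pair-field two-point function in bond pairs: for any
matrix `K` on the block (in particular `K = H.toBlock p p`),
`ω_β^K(((P_x)† P_y).toBlock p p) = Σ_{e,e'} (g e/√2)(g e'/√2) ω_β^K(((b_{x,x+e})† b_{y,y+e'}).toBlock p p)`.
[folklore] -/
theorem gibbsState_toBlock_localPairCorr_eq (β : ℝ) (p : Finset (Orb (FermionTorus 2 L)) → Prop)
    [Fintype {s // p s}] [DecidableEq {s // p s}]
    (K : Matrix {s // p s} {s // p s} ℂ) (x y : TorusSite 2 L) :
    gibbsState β K (((localPair g L x)ᴴ * localPair g L y).toBlock p p) =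
      ∑ e ∈ insert (0 : Site 2) unitSteps, ∑ e' ∈ insert (0 : Site 2) unitSteps,
        ((g e / Real.sqrt 2 : ℝ) : ℂ) * ((g e' / Real.sqrt 2 : ℝ) : ℂ) *
          gibbsState β K
            (((bondPair (FermionTorus.ofTorusSite x)
                (FermionTorus.ofTorusSite (x + Torus.proj L e)))ᴴ *
              bondPair (FermionTorus.ofTorusSite y)
                (FermionTorus.ofTorusSite (y + Torus.proj L e'))).toBlock p p) := by
  rw [localPair_eq_sum_bondPair, localPair_eq_sum_bondPair, conjTranspose_sum, Finset.sum_mul,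
    toBlock_sum, map_sum]
  refine Finset.sum_congr rfl fun e _ => ?_
  rw [Finset.mul_sum, toBlock_sum, map_sum]
  refine Finset.sum_congr rfl fun e' _ => ?_
  rw [conjTranspose_smul, Matrix.smul_mul, Matrix.mul_smul, smul_smul, toBlock_smul, map_smul,
    smul_eq_mul]
  congr 1
  rw [Complex.star_def, Complex.conj_ofReal]

/-- **Power-law decay of pair-field correlations in every occupation sector, in two dimensions**
(Koma–Tasaki's Theorem with the canonical average (3), footnote [10] generality, for EVERY form
factor `g : ℤ² → ℝ`): for all `t`, `U`, `μ`, `β ≥ 0`, every predicate `p` on occupation sets of the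
torus with a non-empty block, uniformly in the side `L`:
`|ω^{p}_{β,L}(((P_x)† P_y).toBlock p p)| ≤ C_g (dist(x, y) + 1)^{-f(β|t|)}`,
`C_g = pairFieldDecayConst g`, `f = pairDecayExponent` — the constants of the grand-canonical
`norm_thermalCorr_localPair_le`. [cite: KomaTasakiPRL1992, Theorem eq. (2), eq. (3) and footnote [10]] -/
theorem norm_gibbsState_toBlock_localPairCorr_le (t U μ : ℝ) {β : ℝ} (hβ : 0 ≤ β)
    (p : Finset (Orb (FermionTorus 2 L)) → Prop) [Fintype {s // p s}] [DecidableEq {s // p s}]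
    [DecidablePred p] [Nonempty {s // p s}] (x y : TorusSite 2 L) :
    ‖gibbsState β ((hubbardTorusWith 2 L t U μ).toBlock p p)
        (((localPair g L x)ᴴ * localPair g L y).toBlock p p)‖ ≤
      pairFieldDecayConst g * ((torusDist x y : ℝ) + 1) ^ (-pairDecayExponent (β * |t|)) := by
  set D : ℝ := ((torusDist x y : ℝ) + 1) ^ (-pairDecayExponent (β * |t|)) with hD
  have hD0 : 0 ≤ D := Real.rpow_nonneg (by positivity) _
  set S : Finset (Site 2) := insert (0 : Site 2) unitSteps with hS
  set a : Site 2 → ℝ := fun e => g e / Real.sqrt 2 with ha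
  set K := (hubbardTorusWith 2 L t U μ).toBlock p p with hK
  rw [gibbsState_toBlock_localPairCorr_eq]
  have hterm : ∀ e ∈ S, ∀ e' ∈ S,
      ‖((a e : ℝ) : ℂ) * ((a e' : ℝ) : ℂ) *
        gibbsState β K
          (((bondPair (FermionTorus.ofTorusSite x)
              (FermionTorus.ofTorusSite (x + Torus.proj L e)))ᴴ *
            bondPair (FermionTorus.ofTorusSite y)
              (FermionTorus.ofTorusSite (y + Torus.proj L e'))).toBlock p p)‖ ≤
        |a e| * |a e'| * (4 * Real.exp 2 * D) := by
    intro e he e' he'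
    rw [norm_mul, norm_mul, Complex.norm_real, Complex.norm_real, Real.norm_eq_abs,
      Real.norm_eq_abs]
    refine mul_le_mul_of_nonneg_left ?_ (by positivity)
    exact norm_gibbsState_toBlock_bondPair_torus_le t U μ hβ p x _ y _
      (torusDist_add_proj_le_one x he) (torusDist_add_proj_le_one y he')
  calc ‖∑ e ∈ S, ∑ e' ∈ S, ((a e : ℝ) : ℂ) * ((a e' : ℝ) : ℂ) *
        gibbsState β K
          (((bondPair (FermionTorus.ofTorusSite x)
              (FermionTorus.ofTorusSite (x + Torus.proj L e)))ᴴ *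
            bondPair (FermionTorus.ofTorusSite y)
              (FermionTorus.ofTorusSite (y + Torus.proj L e'))).toBlock p p)‖
      ≤ ∑ e ∈ S, ∑ e' ∈ S, |a e| * |a e'| * (4 * Real.exp 2 * D) := by
        refine (norm_sum_le _ _).trans (Finset.sum_le_sum fun e he => ?_)
        exact (norm_sum_le _ _).trans (Finset.sum_le_sum fun e' he' => hterm e he e' he')
    _ = 4 * Real.exp 2 * (∑ e ∈ S, |a e|) ^ 2 * D := by
        rw [sq, Finset.sum_mul_sum, Finset.mul_sum, Finset.sum_mul]
        refine Finset.sum_congr rfl fun e _ => ?_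
        rw [Finset.mul_sum, Finset.sum_mul]
        refine Finset.sum_congr rfl fun e' _ => ?_
        ring
    _ = pairFieldDecayConst g * D := by rw [pairFieldDecayConst]

/-- The pure model (`μ = 0`, `hubbardTorus 2 L t U` — the Hamiltonian of the crux `LogColdDWaveOrder`
for `t = 1`): `|ω^{p}_{β,L}(((P_x)† P_y).toBlock p p)| ≤ C_g (dist(x, y) + 1)^{-f(β|t|)}` in every
occupation sector with a non-empty block. [cite: KomaTasakiPRL1992, Theorem eq. (2), eq. (3)] -/
theorem norm_gibbsState_toBlock_hubbardTorus_localPairCorr_le (t U : ℝ) {β : ℝ} (hβ : 0 ≤ β)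
    (p : Finset (Orb (FermionTorus 2 L)) → Prop) [Fintype {s // p s}] [DecidableEq {s // p s}]
    [DecidablePred p] [Nonempty {s // p s}] (x y : TorusSite 2 L) :
    ‖gibbsState β ((hubbardTorus 2 L t U).toBlock p p)
        (((localPair g L x)ᴴ * localPair g L y).toBlock p p)‖ ≤
      pairFieldDecayConst g * ((torusDist x y : ℝ) + 1) ^ (-pairDecayExponent (β * |t|)) := by
  rw [← hubbardTorusWith_zero]
  exact norm_gibbsState_toBlock_localPairCorr_le g t U 0 hβ p x y

/-! ### Registered form (sub-goal of crux stmt-HubbardSuperconductivity-8807) -/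

open scoped Classical in
/-- **Sector Koma–Tasaki bound, registered closed form** (sub-goal `logColdSector_pairDecay` of the
crux `LogColdDWaveOrder`): for every form factor `g`, all `t, U`, every `β ≥ 0`, every side `L`,
every predicate `p` on occupation sets of the torus with a non-empty block (in particular the crux's
`(N_L, S^z = 0)` sector) and all sites `x, y`,
`|ω^{p}_{β,L}(((P_x)† P_y).toBlock p p)| ≤ C_g (dist(x,y)+1)^{-f(β|t|)}` for the Gibbs state of the
compressed PURE Hubbard Hamiltonian `(hubbardTorus 2 L t U).toBlock p p`.
[cite: KomaTasakiPRL1992, Theorem eq. (2), eq. (3) and footnote [10]] -/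
theorem logColdSector_pairDecay :
    ∀ (g : Site 2 → ℝ) (t U β : ℝ), 0 ≤ β → ∀ (L : ℕ) [NeZero L]
      (p : Finset (Orb (FermionTorus 2 L)) → Prop) [Nonempty {s // p s}] (x y : TorusSite 2 L),
      ‖Matrix.gibbsState β ((hubbardTorus 2 L t U).toBlock p p)
          (((localPair g L x)ᴴ * localPair g L y).toBlock p p)‖ ≤
        pairFieldDecayConst g * ((torusDist x y : ℝ) + 1) ^ (-pairDecayExponent (β * |t|)) := by
  intro g t U β hβ L _ p _ x y
  exact norm_gibbsState_toBlock_hubbardTorus_localPairCorr_le g t U hβ p x y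

end Torus

end Summit.HubbardSuperconductivity.HubbardSuperconductivity.Theorems.LogColdTorus

end
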